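/-
Copyright (c) 2026 the pub-hodgecm-mathlib formalisation cell (harness21).  Prover seat hodgecm-mathlib-LH7-p06 (g0), «(D-RAM) FOUR-FRAME» road of crux H413, line LH4,
(β-BAL) Stage B, β-BOARD v1 ROW R5b «G₃ ε-BOUNDARY, THE TWO-SLOT CORE» (HEAD = this seat, orbit layer = LH4-p18 (g0)), STEP (β2): THE INDICATORS OF SLOTS 0 AND 2 IN CLOSED FORM
on the orbit representatives.  2026-09-04.
-/
import Summits.HodgeConjecture.HodgeConjecture.Theorems.F0P3cDyRamLabelledOddBoundaryLatticeG3   -- ★ p861535 (this seat): `v_linearSum_latt_G3`, `v_correction_latt_G3`; brings ★ p861251 (`mem_fixedUnitStabilizer_latt_G3_iff`, `v_sub_le_of_mem_fixedUnitStabilizer_latt_G3`)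
import Summits.HodgeConjecture.HodgeConjecture.Theorems.F0P3cDyRamDiagonalKappaSplitCountValues  -- ★ (LH4-p04): brings ★ `normSign_mul_self`, the ★ non-norm dichotomy
import Literature.NumberTheory.LocalFields.WildQuadraticDatumNormSignConductor                    -- ★ (B-p04): `normSign_eq_one_of_fixed_of_v_sub_one_le`, `normSign_mul_eq_of_fixed_of_v_sub_one_le`, `exists_fixed_unit_not_norm_v_sub_one_le`, `normSign_mul_of_fixed`
import HarnessLib

/-!
# Crux `H413`, line LH4 «(D-RAM) FOUR-FRAME» — (β-BAL) Stage B, β-BOARD v1 ROW R5b «G₃ ε-BOUNDARY, TWO-SLOT CORE», STEP (β2): the slot-0 and slot-2 INDICATORS of the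
# character `λ(u) = ω(u₀)·ω(1 + (u₁∕u₀ − 1)·c)` on the fixed stabiliser of a G₃ orbit representative: `𝟙₀ = [2d − 1 ≤ n₁ − ρ − ℓ₀]`, `𝟙₂ = [2d − 1 ≤ ρ]`

Cell `hodgecm-mathlib` (D-0151), FLOOR 0, crux item H413 = `stmt-HodgeConjecture-24833`, route `HCCMUnconditional`; squad F0∕P3c∕LH4.  THEOREMS ONLY (no `def`, no instance, no
notation, no `sorry`, default heartbeats); ★-only imports; lane `--supports stmt-HodgeConjecture-24833 --as helper` (count-neutral); pays NO row, states NO law.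

THE MATHEMATICS.  (β1) (`F0P3cDyRamLabelledOddBoundaryValueG3`) reads the labelled odd value of a G₃ normal form `M₀ = latt (1 0 0; x ϖ^{ρ+s} 0; y z ϖ^{2ρ})` on the capped tube as
`ω(S)·ω(D_i)∕2 · 𝟙_i · stabiliserWeight`, `𝟙_i = [∀ u ∈ S_F(M₀), ω(u_i)·ω(u₀)·ω(1 + (u₁∕u₀ − 1)·c) = 1]`, `c = G₁∕S`, `|c| = |ϖ|^{n₁ − n₃}` (★ p861535 §3).  On LH4-p18 (g0)'s ORBIT
REPRESENTATIVES (letters `x z = −y·ϖ^{ρ+s}·g⁻¹`, `g ∈ F`, `|g| = |ϖ|^s` — e.g. `x = y = (1+g)⁻¹`, `z = −ϖ^{ρ+s}g⁻¹`) the fixed stabiliser is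
`S_F(M₀) = {u ∈ 𝒰 : t = u₁∕u₀ ∈ U_F(ρ+s), u₂∕u₀ ∈ (1 − (t−1)∕g)·U_F(2ρ)}` and contains the WITNESSES `u(a) = (1, 1 + a, 1 − a∕g)` for every σ-fixed `a` with `|a| ≤ |ϖ|^{ρ+s}`
(§1 `witness_mem_fixedUnitStabilizer_latt_G3`).  Hence (§2, §3):
* `𝟙₀`: the correction `(t−1)·c` sweeps the fixed ball of depth `n₁ − ρ − ℓ₀` (★ `v_correction_latt_G3`); `ω ≡ 1` there iff `2d − 1 ≤ n₁ − ρ − ℓ₀` (★ conductor lemmas; the killer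
  is `u(a)`, `a = (c′ − 1)∕c` with `c′` the ★ non-norm unit `≡ 1 (mod ϖ^{2d−2})`) — **`indicator_zero_latt_G3_iff`**.
* `𝟙₂`: `ω(u₂)ω(u₀) = ω(u₂∕u₀)` and `|u₂∕u₀ − 1| ≤ |ϖ|^ρ` on `S_F` (★ tube), while the correction has depth `≥ ρ + 1`; for `ρ ≥ 2d − 1` everything is a norm; for `ρ ≤ 2d − 2`
  the killer is `u(a)`, `a = (c′ − 1)∕(c − g⁻¹)` (`|c| < |g⁻¹|`): `(1 − a∕g)(1 + ac) = c′·(1 − a²c∕(gc′))` with the last factor `≡ 1 (mod ϖ^{2d−1})` — **`indicator_two_latt_G3_iff`**.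
Both indicators are INDEPENDENT of the representative (`g`) and of the polarisation; slot 1 is slot 0 at the swapped datum (LH4-p18 (g0)'s ★ engine).  HONEST LABEL:
count-neutral; R5b, the table identity (SIG-B2b3), (β-BAL), (β), T₊ remain OPEN; `HC_CM` is proved only modulo the 7 printed citations (2 remaining named inputs: hLiu418 =
`stmt-HodgeConjecture-24832`, h413 = `stmt-HodgeConjecture-24833`) until rung 0 closes.

## References
* [Serre1979] J.-P. Serre, *Local Fields*, GTM 67 (1979), Ch. V §3 Prop. 5, Cor. 2–3; Ch. XV §2 (norm residue symbol, conductor `2d − 1` of a ramified quadratic extension).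
* [Kottwitz1986BaseChangeUnits] R. E. Kottwitz, *Base change for unit elements of Hecke algebras*, Compositio Math. 60 (1986), §1 pp. 240–241 (torus stabilisers).
* [LanglandsShelstad1987] R. P. Langlands, D. Shelstad, *On the definition of transfer factors*, Math. Ann. 278 (1987), §3.
-/

set_option autoImplicit false

noncomputable section

namespace Summit.HodgeConjecture.HodgeConjecture.Cruxes.H413.F0P3cDyRamLabelledOddBoundaryIndicatorsG3

open Literature.NumberTheory.Automorphic Literature.NumberTheory.Automorphic.HermitianLattice
open Literature.NumberTheory.Automorphic.UnitaryLatticeTree Literature.NumberTheory.Automorphic.UnitaryThreeFourFrame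
open Literature.NumberTheory.LocalFields Literature.NumberTheory.LocalFields.WildQuadraticDatum
open Summit.HodgeConjecture.HodgeConjecture.Cruxes.H413.F0P3cDyRamFourFramePieces
open Summit.HodgeConjecture.HodgeConjecture.Cruxes.H413.F0P3cDyRamDiagonalTorusDefs
open Summit.HodgeConjecture.HodgeConjecture.Cruxes.H413.F0P3cDyRamDiagonalStrataDefs
open Summit.HodgeConjecture.HodgeConjecture.Cruxes.H413.F0P3cDyRamDiagonalGluedStratumG3
open Summit.HodgeConjecture.HodgeConjecture.Cruxes.H413.F0P3cDyRamLabelledOddBoundaryLatticeG3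
open Summit.HodgeConjecture.HodgeConjecture.Cruxes.H413.F0P3cDyRamDiagonalKappaSplitCountEval (normSign_mul_self)
open scoped Valued WithZero Matrix MatrixGroups

variable {K : Type} [Field K] [Valued K ℤᵐ⁰] {σ : K →+* K} {ϖ : K} {d t : ℕ}

/-! ## §1  The witnesses `u(a) = (1, 1 + a, 1 − a∕g)` lie in the fixed stabiliser of a representative -/

/-- **THE WITNESS `(1, 1+a, 1−a∕g)` IS IN `S_F(M₀)`** for the normal form `latt (1 0 0; x ϖ^{ρ+s} 0; y z ϖ^{2ρ})` with `|x| = 1`, `|z| = |ϖ^ρ|` and the representative relation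
`x·z = −y·ϖ^{ρ+s}·g⁻¹` (`g` σ-fixed, `|g| = |ϖ^s|`), whenever `a` is σ-fixed with `|a| ≤ |ϖ^{ρ+s}|` and `ρ ≥ 1` (the mixed congruence of ★ `mem_fixedUnitStabilizer_latt_G3_iff`
vanishes identically on these vectors). [cite: Kottwitz1986BaseChangeUnits, §1 pp. 240–241] -/
theorem witness_mem_fixedUnitStabilizer_latt_G3 {ϖ : K} (hϖ : Valued.v ϖ = WithZero.exp (-1 : ℤ))
    {ρ s : ℕ} (hρ : 1 ≤ ρ) {x y z g : K} (hx : Valued.v x = 1) (hz : Valued.v z = Valued.v (ϖ ^ ρ)) (hσg : σ g = g) (hg : Valued.v g = Valued.v (ϖ ^ s))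
    (hxyz : x * z = -(y * ϖ ^ (ρ + s) * g⁻¹)) {a : K} (hσa : σ a = a) (ha : Valued.v a ≤ Valued.v (ϖ ^ (ρ + s)))
    (h1 : (1 + a : K) ≠ 0) (h2 : (1 - a / g : K) ≠ 0) :
    (![1, Units.mk0 (1 + a) h1, Units.mk0 (1 - a / g) h2] : Fin 3 → Kˣ) ∈
      fixedUnitStabilizer σ (latt (!![1, 0, 0; x, ϖ ^ (ρ + s), 0; y, z, ϖ ^ (2 * ρ)] : Matrix (Fin 3) (Fin 3) K)) := by
  have hϖ0 : ϖ ≠ 0 := (Valuation.ne_zero_iff Valued.v).1 (by rw [hϖ]; exact WithZero.exp_ne_zero)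
  have hϖ1 : Valued.v ϖ < 1 := by rw [hϖ, ← WithZero.exp_zero, WithZero.exp_lt_exp]; norm_num
  have hq : ∀ n : ℕ, Valued.v (ϖ ^ n) = WithZero.exp (-(n : ℤ)) := fun n => by rw [map_pow, v_varpi_pow hϖ]
  have hg0 : g ≠ 0 := fun h => by
    rw [h, map_zero] at hg; exact (Valuation.ne_zero_iff Valued.v |>.2 (pow_ne_zero s hϖ0)) hg.symm
  have hag : Valued.v (a / g) ≤ Valued.v (ϖ ^ ρ) := by
    rw [map_div₀, hg, div_le_iff₀ ((Valuation.pos_iff _).2 (pow_ne_zero _ hϖ0)), ← map_mul, ← pow_add]; exact ha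
  have hag1 : Valued.v (a / g) < 1 := hag.trans_lt (by rw [map_pow]; exact pow_lt_one₀ zero_le hϖ1 (by omega))
  have ha1 : Valued.v a < 1 := ha.trans_lt (by rw [map_pow]; exact pow_lt_one₀ zero_le hϖ1 (by omega))
  set u : Fin 3 → Kˣ := ![1, Units.mk0 (1 + a) h1, Units.mk0 (1 - a / g) h2] with hudef
  have hu0 : ((u 0 : Kˣ) : K) = 1 := rfl
  have hu1 : ((u 1 : Kˣ) : K) = 1 + a := rfl
  have hu2 : ((u 2 : Kˣ) : K) = 1 - a / g := rfl
  refine (mem_fixedUnitStabilizer_latt_G3_iff σ hϖ0 hx y hz u).2 ⟨(mem_fixedUnitTorus_iff σ u).2 ⟨?_, ?_⟩, ?_, ?_, ?_⟩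
  · intro j
    fin_cases j
    · exact (map_one _ : Valued.v ((1 : Kˣ) : K) = 1)
    · show Valued.v (1 + a) = 1
      exact Valued.v.map_one_add_of_lt ha1
    · show Valued.v (1 - a / g) = 1
      rw [sub_eq_add_neg]; exact Valued.v.map_one_add_of_lt (by rw [Valuation.map_neg]; exact hag1)
  · intro j
    fin_cases j
    · exact (map_one σ : σ ((1 : Kˣ) : K) = 1)
    · show σ (1 + a) = 1 + a
      rw [map_add, map_one, hσa]
    · show σ (1 - a / g) = 1 - a / g
      rw [map_sub, map_one, map_div₀, hσa, hσg]
  · rw [hu1, hu0, add_sub_cancel_left]; exact ha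
  · rw [hu2, hu1, show (1 - a / g : K) - (1 + a) = -(a / g + a) by ring, Valuation.map_neg]
    refine (Valuation.map_add _ _ _).trans (max_le hag (ha.trans ?_))
    rw [hq, hq, WithZero.exp_le_exp]; omega
  · rw [hu2, hu1, hu0, show ((1 - a / g : K) - 1) * y * ϖ ^ (ρ + s) + (1 - (1 + a)) * x * z = -a * (x * z + y * ϖ ^ (ρ + s) * g⁻¹) by rw [div_eq_mul_inv]; ring,
      hxyz, neg_add_cancel, mul_zero, map_zero]
    exact zero_le

/-! ## §2  The slot-0 indicator: `[∀ u ∈ S_F, ω(u₀)·ω(u₀)·ω(1 + (u₁∕u₀ − 1)c) = 1] ↔ 2d − 1 ≤ n₁ − ρ − ℓ₀` -/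

section Indicators

variable [CompleteSpace K] [Fintype 𝓀[K]] {n₁ : ℕ}

/-- **THE SLOT-0 INDICATOR IN CLOSED FORM.**  G₃ representative letters (`|x| = |y| = 1`, `|z| = |ϖ^ρ|`, `x z = −yϖ^{ρ+s}g⁻¹`, `g ∈ F`, `|g| = |ϖ^s|`), polarisation `D`, read
`2k₃ + ℓ₀ = n₃ = 2ρ+s+ℓ₀`, `2k₁ + ℓ₀ = n₁ ≥ 2ρ + ℓ₀ + 1`, unit tokens; `c = G₁∕S` (★ p861535 §3).  Then
`(∀ u ∈ S_F(M₀), ω(u₀)·(ω(u₀)·ω(1 + (u₁∕u₀ − 1)·c)) = 1) ↔ 2d − 1 ≤ n₁ − (ρ + ℓ₀)` (`|2| < 1` for the killer). [cite: Serre1979, Ch. V §3 Cor. 3; Ch. XV §2]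
[cite: Kottwitz1986BaseChangeUnits, §1 pp. 240–241] -/
theorem indicator_zero_latt_G3_iff (hD : IsRamifiedQuadraticDatum σ ϖ d t) (h2 : Valued.v (2 : K) < 1)
    {ρ s : ℕ} (hρ : 1 ≤ ρ) (hs : 1 ≤ s) {x y z g : K} (hx : Valued.v x = 1) (hy : Valued.v y = 1) (hz : Valued.v z = Valued.v (ϖ ^ ρ))
    (hσg : σ g = g) (hg : Valued.v g = Valued.v (ϖ ^ s)) (hxyz : x * z = -(y * ϖ ^ (ρ + s) * g⁻¹))
    (k₃ : ℕ) (hks : 2 * ρ + s = 2 * k₃) (k₁ : ℕ) (hk₁ : 2 * k₁ + d % 2 = n₁) (hn₁ : 2 * ρ + d % 2 + 1 ≤ n₁)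
    {M₀ : Submodule 𝒪[K] (Fin 3 → K)} (hM₀ : M₀ = latt (!![1, 0, 0; x, ϖ ^ (ρ + s), 0; y, z, ϖ ^ (2 * ρ)] : Matrix (Fin 3) (Fin 3) K))
    {D : Fin 3 → K} (hD₁ : ∀ j, σ (D j) = D j ∧ D j ≠ 0) (hV₁ : IsVertexLattice σ ϖ (Matrix.diagonal D) 0 M₀)
    {eC : K} (hσeC : σ eC = eC) (heC1 : Valued.v eC = 1) {eB : K} (hσeB : σ eB = eB) (heB1 : Valued.v eB = 1) :
    (∀ u ∈ fixedUnitStabilizer σ M₀,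
        normSign σ ((u 0 : Kˣ) : K) *
            (normSign σ ((u 0 : Kˣ) : K) *
              normSign σ (1 + (((u 1 : Kˣ) : K) / ((u 0 : Kˣ) : K) - 1) *
                (D 1 * (σ x * x) * ((ϖ * σ ϖ) ^ k₁ * eB) /
                  (D 0 * ((ϖ * σ ϖ) ^ k₁ * eB - (ϖ * σ ϖ) ^ k₃ * eC) + D 1 * (σ x * x) * ((ϖ * σ ϖ) ^ k₁ * eB))))) = 1) ↔
      2 * d - 1 ≤ n₁ - (ρ + d % 2) := by
  have hD' := hD
  obtain ⟨hσ, -, hϖ, -, -, hd1, -⟩ := hD'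
  haveI : Finite 𝓀[K] := Finite.of_fintype _
  have hϖ0 : ϖ ≠ 0 := fun h0 => by rw [h0, map_zero] at hϖ; exact WithZero.coe_ne_zero hϖ.symm
  have hϖ1 : Valued.v ϖ ≤ 1 := by rw [hϖ, ← WithZero.exp_zero, WithZero.exp_le_exp]; norm_num
  have hq : ∀ n : ℕ, Valued.v (ϖ ^ n) = WithZero.exp (-(n : ℤ)) := fun n => by rw [map_pow, v_varpi_pow hϖ]
  have hπ₀σ : σ (ϖ * σ ϖ) = ϖ * σ ϖ := by rw [map_mul, hσ, mul_comm]
  have hπσ : ∀ k : ℕ, σ ((ϖ * σ ϖ) ^ k) = (ϖ * σ ϖ) ^ k := fun k => by rw [map_pow, hπ₀σ]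
  -- `c`: fixed, `|c| = exp(2ρ+s+ℓ₀ − n₁)`
  obtain ⟨-, hS1, hG1v⟩ := v_linearSum_latt_G3 (n₁ := n₁) hD hρ hs hx hy hz k₃ hks k₁ hk₁ hn₁ hM₀ hD₁ hV₁ heC1 heB1
  set G₁ : K := D 1 * (σ x * x) * ((ϖ * σ ϖ) ^ k₁ * eB) with hG₁def
  set S : K := D 0 * ((ϖ * σ ϖ) ^ k₁ * eB - (ϖ * σ ϖ) ^ k₃ * eC) + G₁ with hSdef
  set c : K := G₁ / S with hcdef
  have hS0 : S ≠ 0 := fun h => by rw [h, map_zero] at hS1; exact zero_ne_one hS1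
  have hσG₁ : σ G₁ = G₁ := by rw [hG₁def]; simp only [map_mul, (hD₁ 1).1, hσ, hπσ, hσeB]; ring
  have hσS : σ S = S := by rw [hSdef, map_add, hσG₁, map_mul, (hD₁ 0).1, map_sub, map_mul, map_mul, hπσ, hπσ, hσeB, hσeC]
  have hσc : σ c = c := by rw [hcdef, map_div₀, hσG₁, hσS]
  have hcv : Valued.v c = WithZero.exp (((2 * ρ + s + d % 2 : ℕ) : ℤ) - n₁) := by
    have h : Valued.v G₁ * Valued.v (ϖ ^ (2 * ρ + s + d % 2)) = Valued.v (ϖ ^ n₁) := hG1v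
    rw [hq, hq] at h
    have hne : WithZero.exp (-((2 * ρ + s + d % 2 : ℕ) : ℤ)) ≠ 0 := WithZero.exp_ne_zero
    rw [hcdef, map_div₀, hS1, div_one]
    calc Valued.v G₁ = Valued.v G₁ * WithZero.exp (-((2 * ρ + s + d % 2 : ℕ) : ℤ)) * (WithZero.exp (-((2 * ρ + s + d % 2 : ℕ) : ℤ)))⁻¹ := by
          rw [mul_inv_cancel_right₀ hne]
      _ = WithZero.exp (-(n₁ : ℤ)) * (WithZero.exp (-((2 * ρ + s + d % 2 : ℕ) : ℤ)))⁻¹ := by rw [h]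
      _ = WithZero.exp (((2 * ρ + s + d % 2 : ℕ) : ℤ) - n₁) := by rw [← WithZero.exp_neg, ← WithZero.exp_add]; congr 1; ring
  have hc0 : c ≠ 0 := fun h => by rw [h, map_zero] at hcv; exact WithZero.coe_ne_zero hcv.symm
  constructor
  · -- (⇒): below the conductor a killer exists
    intro hall
    by_contra hlt
    obtain ⟨c', hσc', hc'1, hc'v, hc'n⟩ := exists_fixed_unit_not_norm_v_sub_one_le hD h2
    -- `a = (c′ − 1)∕c`, `|a| ≤ |ϖ|^{ρ+s}`
    set a : K := (c' - 1) / c with hadef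
    have hσa : σ a = a := by rw [hadef, map_div₀, map_sub, hσc', map_one, hσc]
    have ha : Valued.v a ≤ Valued.v (ϖ ^ (ρ + s)) := by
      rw [hadef, map_div₀, hcv, hq, div_eq_mul_inv, ← WithZero.exp_neg]
      calc Valued.v (c' - 1) * WithZero.exp (-((((2 * ρ + s + d % 2 : ℕ) : ℤ) - n₁)))
          ≤ WithZero.exp (-(2 * ((d - 1 : ℕ) : ℤ))) * WithZero.exp (-((((2 * ρ + s + d % 2 : ℕ) : ℤ) - n₁))) := by gcongr
        _ ≤ WithZero.exp (-((ρ + s : ℕ) : ℤ)) := by rw [← WithZero.exp_add, WithZero.exp_le_exp]; push_cast; omega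
    have hϖlt : Valued.v ϖ < 1 := by rw [hϖ, ← WithZero.exp_zero, WithZero.exp_lt_exp]; norm_num
    have ha1 : Valued.v a < 1 := ha.trans_lt (by rw [map_pow]; exact pow_lt_one₀ zero_le hϖlt (by omega))
    have hg0 : g ≠ 0 := fun h => by
      rw [h, map_zero] at hg; exact (Valuation.ne_zero_iff Valued.v |>.2 (pow_ne_zero s hϖ0)) hg.symm
    have hag1 : Valued.v (a / g) < 1 := by
      rw [map_div₀, hg, div_lt_iff₀ ((Valuation.pos_iff _).2 (pow_ne_zero _ hϖ0))]
      refine ha.trans_lt ?_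
      rw [one_mul, hq, hq, WithZero.exp_lt_exp]; omega
    have h1 : (1 + a : K) ≠ 0 := fun h => by
      have := Valued.v.map_one_add_of_lt ha1; rw [h, map_zero] at this; exact zero_ne_one this
    have h2' : (1 - a / g : K) ≠ 0 := fun h => by
      have := Valued.v.map_one_add_of_lt (x := -(a / g)) (by rw [Valuation.map_neg]; exact hag1)
      rw [← sub_eq_add_neg, h, map_zero] at this; exact zero_ne_one this
    have hmem := witness_mem_fixedUnitStabilizer_latt_G3 hϖ hρ hx hz hσg hg hxyz hσa ha h1 h2'
    rw [← hM₀] at hmem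
    have hval := hall _ hmem
    have hu0 : (((![1, Units.mk0 (1 + a) h1, Units.mk0 (1 - a / g) h2'] : Fin 3 → Kˣ) 0 : Kˣ) : K) = 1 := rfl
    have hu1 : (((![1, Units.mk0 (1 + a) h1, Units.mk0 (1 - a / g) h2'] : Fin 3 → Kˣ) 1 : Kˣ) : K) = 1 + a := rfl
    rw [hu0, hu1, div_one, add_sub_cancel_left, show (1 + a * c : K) = c' by rw [hadef, div_mul_cancel₀ _ hc0]; ring,
      (show normSign σ (1 : K) = 1 from normSign_of_isNorm σ ⟨1, by rw [map_one, one_mul]⟩), normSign_of_not_isNorm σ hc'n] at hval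
    norm_num at hval
  · -- (⇐): above the conductor the correction is a norm
    intro hdepth u hu
    rw [← mul_assoc, normSign_mul_self, one_mul]
    obtain ⟨-, huσ⟩ := (mem_fixedUnitTorus_iff σ u).1 (Subgroup.mem_inf.1 (show u ∈ fixedUnitStabilizer σ M₀ from hu)).2
    have hcorr := v_correction_latt_G3 (n₁ := n₁) hD hρ hs hx hy hz k₃ hks k₁ hk₁ hn₁ hM₀ hD₁ hV₁ heC1 heB1 hu
    have hσw : σ (1 + (((u 1 : Kˣ) : K) / ((u 0 : Kˣ) : K) - 1) * c) = 1 + (((u 1 : Kˣ) : K) / ((u 0 : Kˣ) : K) - 1) * c := by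
      rw [map_add, map_one, map_mul, map_sub, map_div₀, huσ 1, huσ 0, map_one, hσc]
    exact normSign_eq_one_of_fixed_of_v_sub_one_le hD hσw hdepth (by rw [add_sub_cancel_left]; exact hcorr)

/-! ## §3  The slot-2 indicator: `[∀ u ∈ S_F, ω(u₂)·ω(u₀)·ω(1 + (u₁∕u₀ − 1)c) = 1] ↔ 2d − 1 ≤ ρ` -/

/-- **THE SLOT-2 INDICATOR IN CLOSED FORM.**  Same letters as `indicator_zero_latt_G3_iff`:
`(∀ u ∈ S_F(M₀), ω(u₂)·(ω(u₀)·ω(1 + (u₁∕u₀ − 1)·c)) = 1) ↔ 2d − 1 ≤ ρ` — for `ρ ≥ 2d − 1` the stabiliser tube `|u₂∕u₀ − 1| ≤ |ϖ|^ρ` (★) and the correction depth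
`n₁ − ρ − ℓ₀ ≥ ρ + 1` make every factor a norm; for `ρ ≤ 2d − 2` the killer is `(1, 1+a, 1−a∕g)`, `a = (c′−1)∕(c − g⁻¹)`: `(1 − a∕g)(1 + ac) = c′·(1 − a²c∕(gc′))`.
[cite: Serre1979, Ch. V §3 Cor. 3; Ch. XV §2] [cite: Kottwitz1986BaseChangeUnits, §1 pp. 240–241] -/
theorem indicator_two_latt_G3_iff (hD : IsRamifiedQuadraticDatum σ ϖ d t) (h2 : Valued.v (2 : K) < 1)
    {ρ s : ℕ} (hρ : 1 ≤ ρ) (hs : 1 ≤ s) {x y z g : K} (hx : Valued.v x = 1) (hy : Valued.v y = 1) (hz : Valued.v z = Valued.v (ϖ ^ ρ))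
    (hσg : σ g = g) (hg : Valued.v g = Valued.v (ϖ ^ s)) (hxyz : x * z = -(y * ϖ ^ (ρ + s) * g⁻¹))
    (k₃ : ℕ) (hks : 2 * ρ + s = 2 * k₃) (k₁ : ℕ) (hk₁ : 2 * k₁ + d % 2 = n₁) (hn₁ : 2 * ρ + d % 2 + 1 ≤ n₁)
    {M₀ : Submodule 𝒪[K] (Fin 3 → K)} (hM₀ : M₀ = latt (!![1, 0, 0; x, ϖ ^ (ρ + s), 0; y, z, ϖ ^ (2 * ρ)] : Matrix (Fin 3) (Fin 3) K))
    {D : Fin 3 → K} (hD₁ : ∀ j, σ (D j) = D j ∧ D j ≠ 0) (hV₁ : IsVertexLattice σ ϖ (Matrix.diagonal D) 0 M₀)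
    {eC : K} (hσeC : σ eC = eC) (heC1 : Valued.v eC = 1) {eB : K} (hσeB : σ eB = eB) (heB1 : Valued.v eB = 1) :
    (∀ u ∈ fixedUnitStabilizer σ M₀,
        normSign σ ((u 2 : Kˣ) : K) *
            (normSign σ ((u 0 : Kˣ) : K) *
              normSign σ (1 + (((u 1 : Kˣ) : K) / ((u 0 : Kˣ) : K) - 1) *
                (D 1 * (σ x * x) * ((ϖ * σ ϖ) ^ k₁ * eB) /
                  (D 0 * ((ϖ * σ ϖ) ^ k₁ * eB - (ϖ * σ ϖ) ^ k₃ * eC) + D 1 * (σ x * x) * ((ϖ * σ ϖ) ^ k₁ * eB))))) = 1) ↔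
      2 * d - 1 ≤ ρ := by
  have hD' := hD
  obtain ⟨hσ, -, hϖ, -, -, hd1, -⟩ := hD'
  haveI : Finite 𝓀[K] := Finite.of_fintype _
  have hϖ0 : ϖ ≠ 0 := fun h0 => by rw [h0, map_zero] at hϖ; exact WithZero.coe_ne_zero hϖ.symm
  have hϖ1 : Valued.v ϖ ≤ 1 := by rw [hϖ, ← WithZero.exp_zero, WithZero.exp_le_exp]; norm_num
  have hϖlt : Valued.v ϖ < 1 := by rw [hϖ, ← WithZero.exp_zero, WithZero.exp_lt_exp]; norm_num
  have hq : ∀ n : ℕ, Valued.v (ϖ ^ n) = WithZero.exp (-(n : ℤ)) := fun n => by rw [map_pow, v_varpi_pow hϖ]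
  have hπ₀σ : σ (ϖ * σ ϖ) = ϖ * σ ϖ := by rw [map_mul, hσ, mul_comm]
  have hπσ : ∀ k : ℕ, σ ((ϖ * σ ϖ) ^ k) = (ϖ * σ ϖ) ^ k := fun k => by rw [map_pow, hπ₀σ]
  have hg0 : g ≠ 0 := fun h => by
    rw [h, map_zero] at hg; exact (Valuation.ne_zero_iff Valued.v |>.2 (pow_ne_zero s hϖ0)) hg.symm
  obtain ⟨-, hS1, hG1v⟩ := v_linearSum_latt_G3 (n₁ := n₁) hD hρ hs hx hy hz k₃ hks k₁ hk₁ hn₁ hM₀ hD₁ hV₁ heC1 heB1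
  set G₁ : K := D 1 * (σ x * x) * ((ϖ * σ ϖ) ^ k₁ * eB) with hG₁def
  set S : K := D 0 * ((ϖ * σ ϖ) ^ k₁ * eB - (ϖ * σ ϖ) ^ k₃ * eC) + G₁ with hSdef
  set c : K := G₁ / S with hcdef
  have hS0 : S ≠ 0 := fun h => by rw [h, map_zero] at hS1; exact zero_ne_one hS1
  have hσG₁ : σ G₁ = G₁ := by rw [hG₁def]; simp only [map_mul, (hD₁ 1).1, hσ, hπσ, hσeB]; ring
  have hσS : σ S = S := by rw [hSdef, map_add, hσG₁, map_mul, (hD₁ 0).1, map_sub, map_mul, map_mul, hπσ, hπσ, hσeB, hσeC]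
  have hσc : σ c = c := by rw [hcdef, map_div₀, hσG₁, hσS]
  have hcv : Valued.v c = WithZero.exp (((2 * ρ + s + d % 2 : ℕ) : ℤ) - n₁) := by
    have h : Valued.v G₁ * Valued.v (ϖ ^ (2 * ρ + s + d % 2)) = Valued.v (ϖ ^ n₁) := hG1v
    rw [hq, hq] at h
    have hne : WithZero.exp (-((2 * ρ + s + d % 2 : ℕ) : ℤ)) ≠ 0 := WithZero.exp_ne_zero
    rw [hcdef, map_div₀, hS1, div_one]
    calc Valued.v G₁ = Valued.v G₁ * WithZero.exp (-((2 * ρ + s + d % 2 : ℕ) : ℤ)) * (WithZero.exp (-((2 * ρ + s + d % 2 : ℕ) : ℤ)))⁻¹ := by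
          rw [mul_inv_cancel_right₀ hne]
      _ = WithZero.exp (-(n₁ : ℤ)) * (WithZero.exp (-((2 * ρ + s + d % 2 : ℕ) : ℤ)))⁻¹ := by rw [h]
      _ = WithZero.exp (((2 * ρ + s + d % 2 : ℕ) : ℤ) - n₁) := by rw [← WithZero.exp_neg, ← WithZero.exp_add]; congr 1; ring
  -- `|c| < |g⁻¹|`, so `|c − g⁻¹| = |g⁻¹| = exp s`
  have hginv : Valued.v g⁻¹ = WithZero.exp ((s : ℕ) : ℤ) := by rw [map_inv₀, hg, hq, ← WithZero.exp_neg, neg_neg]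
  have hcg : Valued.v c < Valued.v g⁻¹ := by rw [hcv, hginv, WithZero.exp_lt_exp]; push_cast; omega
  have hcg' : Valued.v (c - g⁻¹) = WithZero.exp ((s : ℕ) : ℤ) := by rw [Valuation.map_sub_eq_of_lt_right _ hcg, hginv]
  have hcg0 : c - g⁻¹ ≠ 0 := fun h => by rw [h, map_zero] at hcg'; exact WithZero.coe_ne_zero hcg'.symm
  constructor
  · -- (⇒): for `ρ ≤ 2d − 2` a killer exists
    intro hall
    by_contra hlt
    obtain ⟨c', hσc', hc'1, hc'v, hc'n⟩ := exists_fixed_unit_not_norm_v_sub_one_le hD h2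
    have hc'0 : c' ≠ 0 := fun h => by rw [h, map_zero] at hc'1; exact zero_ne_one hc'1
    set a : K := (c' - 1) / (c - g⁻¹) with hadef
    have hσa : σ a = a := by rw [hadef, map_div₀, map_sub, hσc', map_one, map_sub, hσc, map_inv₀, hσg]
    have hav : Valued.v a ≤ WithZero.exp (-(2 * ((d - 1 : ℕ) : ℤ)) - s) := by
      rw [hadef, map_div₀, hcg', div_eq_mul_inv, ← WithZero.exp_neg, sub_eq_add_neg (-(2 * ((d - 1 : ℕ) : ℤ))), WithZero.exp_add]
      gcongr
    have ha : Valued.v a ≤ Valued.v (ϖ ^ (ρ + s)) := by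
      refine hav.trans ?_
      rw [hq, WithZero.exp_le_exp]; push_cast; omega
    have ha1 : Valued.v a < 1 := ha.trans_lt (by rw [map_pow]; exact pow_lt_one₀ zero_le hϖlt (by omega))
    have hag : Valued.v (a / g) ≤ WithZero.exp (-(2 * ((d - 1 : ℕ) : ℤ))) := by
      rw [map_div₀, hg, hq, div_eq_mul_inv, ← WithZero.exp_neg, neg_neg]
      calc Valued.v a * WithZero.exp ((s : ℕ) : ℤ) ≤ WithZero.exp (-(2 * ((d - 1 : ℕ) : ℤ)) - s) * WithZero.exp ((s : ℕ) : ℤ) := by gcongr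
        _ = WithZero.exp (-(2 * ((d - 1 : ℕ) : ℤ))) := by rw [← WithZero.exp_add]; congr 1; ring
    have hag1 : Valued.v (a / g) < 1 := hag.trans_lt (by rw [← WithZero.exp_zero, WithZero.exp_lt_exp]; omega)
    have h1 : (1 + a : K) ≠ 0 := fun h => by
      have := Valued.v.map_one_add_of_lt ha1; rw [h, map_zero] at this; exact zero_ne_one this
    have h2' : (1 - a / g : K) ≠ 0 := fun h => by
      have := Valued.v.map_one_add_of_lt (x := -(a / g)) (by rw [Valuation.map_neg]; exact hag1)
      rw [← sub_eq_add_neg, h, map_zero] at this; exact zero_ne_one this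
    have hmem := witness_mem_fixedUnitStabilizer_latt_G3 hϖ hρ hx hz hσg hg hxyz hσa ha h1 h2'
    rw [← hM₀] at hmem
    have hval := hall _ hmem
    have hu0 : (((![1, Units.mk0 (1 + a) h1, Units.mk0 (1 - a / g) h2'] : Fin 3 → Kˣ) 0 : Kˣ) : K) = 1 := rfl
    have hu1 : (((![1, Units.mk0 (1 + a) h1, Units.mk0 (1 - a / g) h2'] : Fin 3 → Kˣ) 1 : Kˣ) : K) = 1 + a := rfl
    have hu2 : (((![1, Units.mk0 (1 + a) h1, Units.mk0 (1 - a / g) h2'] : Fin 3 → Kˣ) 2 : Kˣ) : K) = 1 - a / g := rfl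
    rw [hu0, hu1, hu2, div_one, add_sub_cancel_left, (show normSign σ (1 : K) = 1 from normSign_of_isNorm σ ⟨1, by rw [map_one, one_mul]⟩), one_mul] at hval
    -- `(1 − a∕g)(1 + ac) = c′·w`, `w = 1 − a²c∕(g c′)`, `|w − 1| ≤ |ϖ|^{2d−1}`
    have hσ1a : σ (1 - a / g) = 1 - a / g := by rw [map_sub, map_one, map_div₀, hσa, hσg]
    have hσac : σ (1 + a * c) = 1 + a * c := by rw [map_add, map_one, map_mul, hσa, hσc]
    have hac1 : Valued.v (a * c) < 1 := by
      rw [map_mul]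
      calc Valued.v a * Valued.v c ≤ Valued.v (ϖ ^ (ρ + s)) * Valued.v c := by gcongr
        _ < 1 := by rw [hq, hcv, ← WithZero.exp_add, ← WithZero.exp_zero, WithZero.exp_lt_exp]; push_cast; omega
    have hac0 : (1 + a * c : K) ≠ 0 := fun h => by
      have := Valued.v.map_one_add_of_lt hac1; rw [h, map_zero] at this; exact zero_ne_one this
    rw [← normSign_mul_of_fixed hD hσ1a hσac h2' hac0] at hval
    set w : K := 1 - a ^ 2 * c / (g * c') with hwdef
    have hprod : (1 - a / g) * (1 + a * c) = c' * w := by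
      have hkey : a * (c - g⁻¹) = c' - 1 := by rw [hadef, div_mul_cancel₀ _ hcg0]
      have e1 : (1 - a / g) * (1 + a * c) = 1 + a * (c - g⁻¹) - a ^ 2 * c / g := by ring
      have e2 : c' * w = c' - a ^ 2 * c / g := by
        rw [hwdef, mul_sub, mul_one, mul_div_assoc', mul_comm g c', mul_div_mul_left _ _ hc'0]
      rw [e1, e2, hkey]; ring
    have hσw : σ w = w := by rw [hwdef, map_sub, map_one, map_div₀, map_mul, map_pow, hσa, hσc, map_mul, hσg, hσc']
    have hwv : Valued.v (w - 1) ≤ Valued.v ϖ ^ (2 * d - 1) := by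
      rw [hwdef, sub_sub_cancel_left, Valuation.map_neg, map_div₀, map_mul, map_pow, map_mul, hc'1, mul_one, hcv, hg, hq, v_varpi_pow hϖ,
        div_eq_mul_inv, ← WithZero.exp_neg]
      calc Valued.v a ^ 2 * WithZero.exp (((2 * ρ + s + d % 2 : ℕ) : ℤ) - n₁) * WithZero.exp (-(-((s : ℕ) : ℤ)))
          ≤ WithZero.exp (-(2 * ((d - 1 : ℕ) : ℤ)) - s) ^ 2 * WithZero.exp (((2 * ρ + s + d % 2 : ℕ) : ℤ) - n₁) * WithZero.exp (-(-((s : ℕ) : ℤ))) :=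
            mul_le_mul' (mul_le_mul' (pow_le_pow_left' hav 2) le_rfl) le_rfl
        _ ≤ WithZero.exp (-((2 * d - 1 : ℕ) : ℤ)) := by
          rw [← WithZero.exp_nsmul, nsmul_eq_mul, ← WithZero.exp_add, ← WithZero.exp_add, WithZero.exp_le_exp]; push_cast; omega
    rw [hprod, normSign_mul_eq_neg_of_not_norm hD hσc' hc'n hσw ?_] at hval
    · have hw1 : normSign σ w = 1 := normSign_eq_one_of_fixed_of_v_sub_one_le hD hσw (le_refl _) hwv
      rw [hw1] at hval
      norm_num at hval
    · intro h
      rw [h, zero_sub, Valuation.map_neg, map_one] at hwv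
      have : Valued.v ϖ ^ (2 * d - 1) < 1 := pow_lt_one₀ zero_le hϖlt (by omega)
      exact absurd (hwv.trans_lt this) (lt_irrefl _)
  · -- (⇐): for `ρ ≥ 2d − 1` every factor is a norm
    intro hdepth u hu
    obtain ⟨huv, huσ⟩ := (mem_fixedUnitTorus_iff σ u).1 (Subgroup.mem_inf.1 (show u ∈ fixedUnitStabilizer σ M₀ from hu)).2
    have hu' := hu
    rw [hM₀] at hu'
    obtain ⟨-, -, h20⟩ := v_sub_le_of_mem_fixedUnitStabilizer_latt_G3 σ hϖ0 hϖ1 hx hz hu'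
    have hcorr := v_correction_latt_G3 (n₁ := n₁) hD hρ hs hx hy hz k₃ hks k₁ hk₁ hn₁ hM₀ hD₁ hV₁ heC1 heB1 hu
    have hσw : σ (1 + (((u 1 : Kˣ) : K) / ((u 0 : Kˣ) : K) - 1) * c) = 1 + (((u 1 : Kˣ) : K) / ((u 0 : Kˣ) : K) - 1) * c := by
      rw [map_add, map_one, map_mul, map_sub, map_div₀, huσ 1, huσ 0, map_one, hσc]
    have hw1 : normSign σ (1 + (((u 1 : Kˣ) : K) / ((u 0 : Kˣ) : K) - 1) * c) = 1 :=
      normSign_eq_one_of_fixed_of_v_sub_one_le hD hσw (show 2 * d - 1 ≤ n₁ - (ρ + d % 2) by omega) (by rw [add_sub_cancel_left]; exact hcorr)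
    rw [hw1, mul_one, ← normSign_mul_of_fixed hD (huσ 2) (huσ 0) (u 2).ne_zero (u 0).ne_zero]
    -- `u₂ u₀ = (u₀ u₀) · (u₂∕u₀)`, a norm times a unit `≡ 1 (mod ϖ^ρ)`
    have hv : Valued.v (((u 2 : Kˣ) : K) / ((u 0 : Kˣ) : K) - 1) ≤ Valued.v ϖ ^ ρ := by
      rw [show ((u 2 : Kˣ) : K) / ((u 0 : Kˣ) : K) - 1 = (((u 2 : Kˣ) : K) - (u 0 : Kˣ)) / ((u 0 : Kˣ) : K) by field_simp, map_div₀, huv 0, div_one, ← map_pow]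
      exact h20
    have hσv : σ (((u 2 : Kˣ) : K) / ((u 0 : Kˣ) : K)) = ((u 2 : Kˣ) : K) / ((u 0 : Kˣ) : K) := by rw [map_div₀, huσ 2, huσ 0]
    rw [show ((u 2 : Kˣ) : K) * ((u 0 : Kˣ) : K) = ((u 0 : Kˣ) : K) * ((u 0 : Kˣ) : K) * (((u 2 : Kˣ) : K) / ((u 0 : Kˣ) : K)) by field_simp,
      normSign_mul_eq_of_fixed_of_v_sub_one_le hD _ hσv hdepth hv]
    exact normSign_of_isNorm σ ⟨((u 0 : Kˣ) : K), by rw [huσ 0]⟩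

end Indicators

end Summit.HodgeConjecture.HodgeConjecture.Cruxes.H413.F0P3cDyRamLabelledOddBoundaryIndicatorsG3

end
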